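import Summits.BirchSwinnertonDyer.BirchSwinnertonDyer.Theorems.PrintCf2SplitBadTwoCMPrimaryStructure
import Literature.NumberTheory.EllipticCurves.EndomorphismEigenPrimaryTorsion
import HarnessLib

set_option autoImplicit false

/-!
# Crux `PrintCf2.SplitBadTwoRankOneOfFacts` (stmt-BirchSwinnertonDyer-20368), road α v10.3, S3b′ TWIST step —
# file 1 of 2: an `End_K(E)`-stable subgroup of `E_K[2^∞]` with cyclic layers IS one of the two CM
# eigen-summands `E[𝔮_r^∞]`, `E[𝔮_{1−r}^∞]` (the algebra behind «the pinned summand is Deuring's `E[v̄^∞]`»)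

Cell `bsd-print-cf2`, typer seat ty2 g30 (`P2/` = the typer's Summits-side files), serving crux
stmt-BirchSwinnertonDyer-20368 (`Summits/BirchSwinnertonDyer/BirchSwinnertonDyer/Theorems/PrintCf2SplitBadTwo*`).
HONEST FRAMING: THEOREMS ONLY (no definition, no named fact, no `sorry`); nothing here closes a crux or a stub;
BSD is not proved by any of this; beyond-print theorem: no. File 2 (`PrintCf2DeuringGaloisSummand.lean`)
applies this to the components `E[v^∞]`, `E[v̄^∞]` of the print `Deuring_galoisAction_cmPrimaryTorsion_split`.

For `W/ℚ` with `j = −3375`, a number field `K ∋ θ`, `θ² = −7`, a `K`-rational `π` with `π² = π − 2` and a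
`2`-adic root `r` of `X² − X + 2` (the objects of -w2's `PrintCf2SplitBadTwoCMPrimary*.lean`):

* `mem_endEigenPrimaryTorsion_of_level` — membership in `E[𝔮_ρ^∞]` from ONE level (`pᵏ x = 0`,
  `π x = N₁ x`, `N₁ ≡ ρ (mod pᵏ)`); generic `p`;
* `le_endEigen_or_le_endEigen_of_cyclicLayers` — a `π`-stable `M ≤ E_K[2^∞]` with `M[2ᵏ] = ℤ·gₖ`,
  `ord gₖ = 2ᵏ`, lies in `E[𝔮_r^∞]` or in `E[𝔮_{1−r}^∞]` (level `k`: `π gₖ = N gₖ`, `(N² − N + 2) gₖ = 0`,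
  `(N − R₁)(N − R₂) gₖ = 0` with `R₁ ≡ r`, `R₂ ≡ 1 − r`, `R₁ − R₂ ≡ 2r − 1` a `2`-adic unit, so exactly one
  factor is even and the other kills `gₖ`; the side is level-independent because a non-member at one level and
  a member at another would meet in a common higher level);
* `endEigen_eq_of_complementary_cyclicLayers` — two such subgroups with `M' ⊔ M = ⊤` ARE the two
  eigen-summands: `E[𝔮_ρ^∞] = M`, `E[𝔮_{1−ρ}^∞] = M'` for a root `ρ ∈ {r, 1 − r}` (they cannot share a summand,
  the other being non-zero, -w2 `exists_eigen_pair_two`; equality by the modular law).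

References: K. Rubin, LNM 1716 (1999), §2, Prop. 5.4 (`E[𝔭ᵏ] ≅ 𝓞/𝔭ᵏ`); [SilvermanATAEC1994] II §1 Prop. 1.1,
App. A §3.
-/

noncomputable section

open scoped Classical
open NumberField IsDedekindDomain WeierstrassCurve Field
open Literature.NumberTheory.EllipticCurves Literature.NumberTheory.GaloisRepresentations
open Summit.BirchSwinnertonDyer.BirchSwinnertonDyer.Theorems.PrintCf2

namespace Summit.BirchSwinnertonDyer.Rank1Residual.P2.DeuringGaloisSummandEigen

variable {K : Type} [Field K] [NumberField K]

/-! ## §1 An `End`-stable subgroup with cyclic layers lies in one eigen-summand -/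

section Identify

variable (V : WeierstrassCurve K) {p : ℕ} [Fact p.Prime]

omit [NumberField K] in
/-- **Membership in an eigen-summand from ONE level** (the subgroup form of -w2's `eigen_of_level`): if
`pᵏ x = 0` and `π x = N₁ x` for one integer `N₁ ≡ ρ (mod pᵏ)`, then `x ∈ E[𝔮_ρ^∞]`. [folklore] -/
theorem mem_endEigenPrimaryTorsion_of_level (π : V.endRing) (ρ : ℤ_[p]) {x : V.geomPrimaryTorsion p}
    {k : ℕ} (hx : p ^ k • x = 0) {N₁ : ℤ}
    (hN₁ : ((N₁ : ℤ_[p]) - ρ) ∈ (Ideal.span {(p : ℤ_[p]) ^ k} : Ideal ℤ_[p]))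
    (h : (π : AddMonoid.End V.geomPoints) (x : V.geomPoints) = N₁ • (x : V.geomPoints)) :
    x ∈ V.endEigenPrimaryTorsion p π ρ := by
  intro k' N hk' hN
  rw [h]
  have hle : ∀ {j i : ℕ}, j ≤ i →
      (Ideal.span {(p : ℤ_[p]) ^ i} : Ideal ℤ_[p]) ≤ Ideal.span {(p : ℤ_[p]) ^ j} :=
    fun hji ↦ Ideal.span_singleton_le_span_singleton.mpr (pow_dvd_pow _ hji)
  have hxj : p ^ min k k' • x = 0 := by
    rcases le_total k k' with hkk | hkk
    · rw [min_eq_left hkk, hx]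
    · rw [min_eq_right hkk, hk']
  have e := CMPrimes.zsmul_eq_zsmul_of_pow_dvd_sub hxj
    (CMPrimes.pow_dvd_sub_of_sub_mem_span (hle (min_le_left k k') hN₁) (hle (min_le_right k k') hN))
  have e' := congrArg Subtype.val e
  simpa only [AddSubgroupClass.coe_zsmul] using e'

variable (W : WeierstrassCurve ℚ) [W.IsElliptic] (K)

omit [W.IsElliptic] in
/-- **An `End_K(E)`-stable subgroup of `E_K[2^∞]` with cyclic layers lies in one of the two CM
eigen-summands.** `W/ℚ` with `j = −3375`, `θ² = −7 ∈ K`, `π² = π − 2`, `r² = r − 2`: if `M ≤ E_K[2^∞]` is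
stable under `π` and `M[2ᵏ] = ℤ·gₖ` with `ord gₖ = 2ᵏ` for every `k`, then `M ≤ E[𝔮_r^∞]` or
`M ≤ E[𝔮_{1−r}^∞]`. Level `k`: `π gₖ = N gₖ`, `(N² − N + 2) gₖ = 0`, so `(N − R₁)(N − R₂) gₖ = 0` for
`R₁ ≡ r`, `R₂ ≡ 1 − r (mod 2ᵏ)`; `R₁ − R₂ ≡ 2r − 1` is odd, so one factor is prime to `2ᵏ` and the other
kills `gₖ`; the summand is the same at all levels since `g₁ ≠ 0` lies in every `M[2ᵏ]`, `k ≥ 1`.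
[cite: Rubin1999, §2 and Prop. 5.4] -/
theorem le_endEigen_or_le_endEigen_of_cyclicLayers
    (π : (W.baseChange K).endRing) (hrel : (π : AddMonoid.End (W.baseChange K).geomPoints) * π = π - 2)
    {r : ℤ_[2]} (hr : r * r = r - 2) {M : AddSubgroup ((W.baseChange K).geomPrimaryTorsion 2)}
    (hMπ : ∀ x ∈ M, ∃ y ∈ M, (y : (W.baseChange K).geomPoints) =
      (π : AddMonoid.End (W.baseChange K).geomPoints) (x : (W.baseChange K).geomPoints))
    (hcyc : ∀ k : ℕ, ∃ g ∈ M, addOrderOf g = 2 ^ k ∧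
      M ⊓ AddSubgroup.torsionBy ((W.baseChange K).geomPrimaryTorsion 2) (2 ^ k : ℕ) =
        AddSubgroup.zmultiples g) :
    M ≤ (W.baseChange K).endEigenPrimaryTorsion 2 π r ∨
      M ≤ (W.baseChange K).endEigenPrimaryTorsion 2 π (1 - r) := by
  haveI : Fact (Nat.Prime 2) := ⟨Nat.prime_two⟩
  obtain ⟨-, hunit⟩ := CMPrimes.two_dvd_or_two_dvd_one_sub_of_root hr
  have hsum : r + (1 - r) = ((1 : ℤ) : ℤ_[2]) := by push_cast; ring
  have hprod : r * (1 - r) = ((2 : ℤ) : ℤ_[2]) := by push_cast; linear_combination -hr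
  -- `2`-adic units: a unit plus an even element is a unit; a non-unit is even
  have hp2 : ((2 : ℕ) : ℤ_[2]) = 2 := rfl
  have hunit_add : ∀ {u t : ℤ_[2]}, IsUnit u → (2 : ℤ_[2]) ∣ t → IsUnit (u + t) := by
    intro u t hu ht
    rw [PadicInt.isUnit_iff] at hu ⊢
    have ht' : ‖t‖ < 1 := (PadicInt.norm_lt_one_iff_dvd t).mpr (by rw [hp2]; exact ht)
    refine le_antisymm (PadicInt.norm_le_one _) ?_
    by_contra hlt
    push Not at hlt
    have : ‖u‖ < 1 := by
      have e : u = (u + t) + (-t) := by ring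
      rw [e]
      exact lt_of_le_of_lt (PadicInt.nonarchimedean _ _) (max_lt hlt (by rwa [norm_neg]))
    exact absurd hu this.ne
  have hdvd_of_not_isUnit : ∀ {z : ℤ_[2]}, ¬ IsUnit z → (2 : ℤ_[2]) ∣ z := by
    intro z hz
    rw [PadicInt.isUnit_iff] at hz
    have : ‖z‖ < 1 := lt_of_le_of_ne (PadicInt.norm_le_one _) hz
    rw [← hp2]
    exact (PadicInt.norm_lt_one_iff_dvd z).mp this
  -- Bézout killing: `IsCoprime (2^k) a`, `(a*b) • g = 0`, `2^k • g = 0` ⟹ `b • g = 0`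
  have hkill : ∀ {g : (W.baseChange K).geomPrimaryTorsion 2} {k : ℕ} {a b : ℤ}, 2 ^ k • g = 0 →
      IsCoprime ((2 : ℤ) ^ k) a → (a * b) • g = 0 → b • g = 0 := by
    intro g k a b hg hcop hab
    obtain ⟨u, w, huw⟩ := hcop
    have hpk : ((2 : ℤ) ^ k) • g = 0 := by
      rw [show ((2 : ℤ) ^ k) = ((2 ^ k : ℕ) : ℤ) by push_cast; rfl, natCast_zsmul, hg]
    calc b • g = (u * 2 ^ k + w * a) • (b • g) := by rw [huw, one_smul]
      _ = u • b • (((2 : ℤ) ^ k) • g) + w • ((a * b) • g) := by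
          rw [add_smul, mul_smul, mul_smul, mul_smul, smul_comm b ((2 : ℤ) ^ k) g]
      _ = 0 := by rw [hpk, hab, smul_zero, smul_zero, smul_zero, zero_add]
  -- LEVEL CLAIM
  have hlevel : ∀ k : ℕ,
      (∀ x ∈ M, 2 ^ k • x = 0 → x ∈ (W.baseChange K).endEigenPrimaryTorsion 2 π r) ∨
      (∀ x ∈ M, 2 ^ k • x = 0 → x ∈ (W.baseChange K).endEigenPrimaryTorsion 2 π (1 - r)) := by
    intro k
    rcases Nat.eq_zero_or_pos k with hk0 | hkpos
    · subst hk0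
      left
      intro x _ hx
      rw [pow_zero, one_smul] at hx
      rw [hx]
      exact AddSubgroup.zero_mem _
    obtain ⟨g, hgM, hord, hgen⟩ := hcyc k
    have hg2 : 2 ^ k • g = 0 := by rw [← hord]; exact addOrderOf_nsmul_eq_zero g
    -- every `x ∈ M[2^k]` is a multiple of `g`
    have hmult : ∀ x ∈ M, 2 ^ k • x = 0 → x ∈ AddSubgroup.zmultiples g := fun x hx hxk ↦ by
      rw [← hgen]
      exact ⟨hx, AddSubgroup.torsionBy.nsmul_iff.mpr hxk⟩
    -- `π g = N • g`
    obtain ⟨y, hyM, hy⟩ := hMπ g hgM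
    have hy2 : 2 ^ k • y = 0 := by
      apply Subtype.ext
      rw [AddSubmonoidClass.coe_nsmul, hy, ← map_nsmul, ← AddSubmonoidClass.coe_nsmul, hg2,
        ZeroMemClass.coe_zero, map_zero]
    obtain ⟨N, hN⟩ := AddSubgroup.mem_zmultiples_iff.mp (hmult y hyM hy2)
    have hπg : (π : AddMonoid.End (W.baseChange K).geomPoints) (g : (W.baseChange K).geomPoints) = N • (g : (W.baseChange K).geomPoints) := by
      rw [← hy, ← hN, AddSubgroupClass.coe_zsmul]
    -- `(N*N - N + 2) • g = 0`
    have hquad : (N * N - N + 2) • g = 0 := by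
      apply Subtype.ext
      have h := CMPrimes.cmEndo_apply_apply (W.baseChange K) hrel (g : (W.baseChange K).geomPoints)
      rw [hπg, map_zsmul, hπg, smul_smul] at h
      rw [AddSubgroupClass.coe_zsmul, ZeroMemClass.coe_zero, add_smul, sub_smul, h, ofNat_zsmul]
      abel
    obtain ⟨R₁, hR₁⟩ := CMPrimes.exists_int_sub_mem_span r k
    obtain ⟨R₂, hR₂⟩ := CMPrimes.exists_int_sub_mem_span (1 - r) k
    obtain ⟨hds, hdp⟩ := CMPrimes.pow_dvd_add_sub_and_mul_sub hsum hprod hR₁ hR₂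
    have hprod0 : ((N - R₁) * (N - R₂)) • g = 0 := by
      have hdvd : (2 ^ k : ℤ) ∣ (N - R₁) * (N - R₂) - (N * N - N + 2) := by
        have e : (N - R₁) * (N - R₂) - (N * N - N + 2) = -(R₁ + R₂ - 1) * N + (R₁ * R₂ - 2) := by ring
        rw [e]
        exact dvd_add (dvd_mul_of_dvd_left ((dvd_neg).mpr hds) _) hdp
      rw [CMPrimes.zsmul_eq_zsmul_of_pow_dvd_sub hg2 hdvd, hquad]
    -- `R₁ - R₂ ≡ r - (1 - r)` is a unit
    have h2k : (2 : ℤ_[2]) ∣ (2 : ℤ_[2]) ^ k := dvd_pow_self 2 hkpos.ne'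
    have hdiff : IsUnit ((R₁ : ℤ_[2]) - R₂) := by
      have e : (R₁ : ℤ_[2]) - R₂ = (r - (1 - r)) + (((R₁ : ℤ_[2]) - r) - ((R₂ : ℤ_[2]) - (1 - r))) := by ring
      rw [e]
      exact hunit_add hunit (dvd_sub (h2k.trans (Ideal.mem_span_singleton.mp hR₁))
        (h2k.trans (Ideal.mem_span_singleton.mp hR₂)))
    -- the parity dichotomy
    by_cases hu : IsUnit ((N : ℤ_[2]) - (R₁ : ℤ_[2]))
    · -- `N - R₁` is a `2`-adic unit: prime to `2^k`, so `(N - R₂) g = 0` and `g ∈ E[𝔮_{1-r}^∞]`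
      right
      have hcop : IsCoprime ((2 : ℤ) ^ k) (N - R₁) :=
        CMPrimes.isCoprime_pow_of_sub_mem_span_of_isUnit (k := k) hu
          (by push_cast; rw [sub_self]; exact Ideal.zero_mem _)
      have hz : (N - R₂) • g = 0 := hkill hg2 hcop hprod0
      have hπg' : (π : AddMonoid.End (W.baseChange K).geomPoints) (g : (W.baseChange K).geomPoints) = R₂ • (g : (W.baseChange K).geomPoints) := by
        have : N • g = R₂ • g := by rwa [sub_smul, sub_eq_zero] at hz
        rw [hπg, ← AddSubgroupClass.coe_zsmul, this, AddSubgroupClass.coe_zsmul]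
      have hgmem : g ∈ (W.baseChange K).endEigenPrimaryTorsion 2 π (1 - r) :=
        mem_endEigenPrimaryTorsion_of_level (W.baseChange K) π (1 - r) hg2 hR₂ hπg'
      intro x hx hxk
      exact (AddSubgroup.zmultiples_le_of_mem hgmem) (hmult x hx hxk)
    · -- `N - R₁` is even; `N - R₂ = (R₁ - R₂) + (N - R₁)` is a unit, so `(N - R₁) g = 0`, `g ∈ E[𝔮_r^∞]`
      left
      have hu' : IsUnit ((N : ℤ_[2]) - (R₂ : ℤ_[2])) := by
        have e : (N : ℤ_[2]) - R₂ = ((R₁ : ℤ_[2]) - R₂) + ((N : ℤ_[2]) - R₁) := by ring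
        rw [e]
        exact hunit_add hdiff (hdvd_of_not_isUnit hu)
      have hcop : IsCoprime ((2 : ℤ) ^ k) (N - R₂) :=
        CMPrimes.isCoprime_pow_of_sub_mem_span_of_isUnit (k := k) hu'
          (by push_cast; rw [sub_self]; exact Ideal.zero_mem _)
      have hz : (N - R₁) • g = 0 := hkill hg2 hcop (by rw [mul_comm]; exact hprod0)
      have hπg' : (π : AddMonoid.End (W.baseChange K).geomPoints) (g : (W.baseChange K).geomPoints) = R₁ • (g : (W.baseChange K).geomPoints) := by
        have : N • g = R₁ • g := by rwa [sub_smul, sub_eq_zero] at hz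
        rw [hπg, ← AddSubgroupClass.coe_zsmul, this, AddSubgroupClass.coe_zsmul]
      have hgmem : g ∈ (W.baseChange K).endEigenPrimaryTorsion 2 π r :=
        mem_endEigenPrimaryTorsion_of_level (W.baseChange K) π r hg2 hR₁ hπg'
      intro x hx hxk
      exact (AddSubgroup.zmultiples_le_of_mem hgmem) (hmult x hx hxk)
  -- FROM LEVELS TO THE SUBGROUP: primary torsion, so every element lives at some level
  have hlev : ∀ x : (W.baseChange K).geomPrimaryTorsion 2, ∃ k : ℕ, 2 ^ k • x = 0 := fun x ↦ by
    obtain ⟨k, hk⟩ := (AddCommGroup.mem_primaryComponent).mp x.2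
    exact ⟨k, Subtype.ext (by rw [AddSubmonoidClass.coe_nsmul, ZeroMemClass.coe_zero]; exact hk)⟩
  by_cases h1 : M ≤ (W.baseChange K).endEigenPrimaryTorsion 2 π r
  · exact Or.inl h1
  · right
    obtain ⟨x, hxM, hx1⟩ : ∃ x ∈ M, x ∉ (W.baseChange K).endEigenPrimaryTorsion 2 π r := by
      by_contra h
      push Not at h
      exact h1 fun x hx ↦ h x hx
    intro y hy
    obtain ⟨kx, hkx⟩ := hlev x
    obtain ⟨ky, hky⟩ := hlev y
    have hKx : 2 ^ (kx + ky) • x = 0 := by rw [pow_add, mul_comm, mul_smul, hkx, smul_zero]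
    have hKy : 2 ^ (kx + ky) • y = 0 := by rw [pow_add, mul_smul, hky, smul_zero]
    rcases hlevel (kx + ky) with h | h
    · exact absurd (h x hxM hKx) hx1
    · exact h y hy hKy

/-- **Two complementary `End_K(E)`-stable subgroups with cyclic layers ARE the two eigen-summands**:
with `M' ⊔ M = ⊤`, both `π`-stable with cyclic layers of the orders `2ᵏ`, there is a root `ρ ∈ {r, 1 − r}` with
`E[𝔮_ρ^∞] = M` and `E[𝔮_{1−ρ}^∞] = M'` (§1 places each in one summand; they cannot share a summand
since the other summand is non-zero, -w2 `cmPrimary_compl_two`; equality by the modular law).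
[cite: Rubin1999, §2 and Prop. 5.4] -/
theorem endEigen_eq_of_complementary_cyclicLayers (hj : W.j = -3375) {θ : K} (hθ : θ ^ 2 = -7)
    (π : (W.baseChange K).endRing) (hrel : (π : AddMonoid.End (W.baseChange K).geomPoints) * π = π - 2)
    {r : ℤ_[2]} (hr : r * r = r - 2) {M M' : AddSubgroup ((W.baseChange K).geomPrimaryTorsion 2)}
    (hsup : M' ⊔ M = ⊤)
    (hMπ : ∀ x ∈ M, ∃ y ∈ M, (y : (W.baseChange K).geomPoints) =
      (π : AddMonoid.End (W.baseChange K).geomPoints) (x : (W.baseChange K).geomPoints))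
    (hcyc : ∀ k : ℕ, ∃ g ∈ M, addOrderOf g = 2 ^ k ∧
      M ⊓ AddSubgroup.torsionBy ((W.baseChange K).geomPrimaryTorsion 2) (2 ^ k : ℕ) =
        AddSubgroup.zmultiples g)
    (hM'π : ∀ x ∈ M', ∃ y ∈ M', (y : (W.baseChange K).geomPoints) =
      (π : AddMonoid.End (W.baseChange K).geomPoints) (x : (W.baseChange K).geomPoints))
    (hcyc' : ∀ k : ℕ, ∃ g ∈ M', addOrderOf g = 2 ^ k ∧
      M' ⊓ AddSubgroup.torsionBy ((W.baseChange K).geomPrimaryTorsion 2) (2 ^ k : ℕ) =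
        AddSubgroup.zmultiples g) :
    ∃ ρ : ℤ_[2], (ρ = r ∨ ρ = 1 - r) ∧ ρ * ρ = ρ - 2 ∧
      (W.baseChange K).endEigenPrimaryTorsion 2 π ρ = M ∧
      (W.baseChange K).endEigenPrimaryTorsion 2 π (1 - ρ) = M' := by
  haveI : Fact (Nat.Prime 2) := ⟨Nat.prime_two⟩
  have hπg : (π : AddMonoid.End (W.baseChange K).geomPoints) ∈ (W.baseChange K).geomEndRing :=
    (W.baseChange K).endRing_le_geomEndRing π.2
  obtain ⟨C₁, C₂, hC₁, hC₂, hinf₁₂, -, hne₁, hne₂, -⟩ :=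
    CMPrimes.exists_eigen_pair_two W hj K hθ hπg hrel hr
  have hE₁ : (W.baseChange K).endEigenPrimaryTorsion 2 π r = C₁ := by
    ext x; exact ((W.baseChange K).mem_endEigenPrimaryTorsion_iff π r x).trans (hC₁ x).symm
  have hE₂ : (W.baseChange K).endEigenPrimaryTorsion 2 π (1 - r) = C₂ := by
    ext x; exact ((W.baseChange K).mem_endEigenPrimaryTorsion_iff π (1 - r) x).trans (hC₂ x).symm
  have hr' : (1 - r) * (1 - r) = (1 - r) - 2 := by linear_combination hr
  -- sides
  have hsM := le_endEigen_or_le_endEigen_of_cyclicLayers K W π hrel hr hMπ hcyc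
  have hsM' := le_endEigen_or_le_endEigen_of_cyclicLayers K W π hrel hr hM'π hcyc'
  rw [hE₁, hE₂] at hsM hsM'
  -- two subgroups in the same summand would exhaust `⊤`, killing the other summand
  have hexcl : ∀ {D D' : AddSubgroup ((W.baseChange K).geomPrimaryTorsion 2)}, D ⊓ D' = ⊥ → D' ≠ ⊥ →
      ¬ (M ≤ D ∧ M' ≤ D) := by
    rintro D D' hDD' hD' ⟨h, h'⟩
    apply hD'
    rw [eq_bot_iff, ← hDD']
    exact le_inf ((le_top.trans_eq hsup.symm).trans (sup_le h' h)) le_rfl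
  -- equality from inclusion, by complementarity (modular law by hand)
  have heq : ∀ {A B D D' : AddSubgroup ((W.baseChange K).geomPrimaryTorsion 2)}, A ⊔ B = ⊤ → D ⊓ D' = ⊥ →
      A ≤ D → B ≤ D' → D = A := by
    intro A B D D' hAB hDD' h h'
    refine le_antisymm (fun x hx ↦ ?_) h
    have hx' : x ∈ A ⊔ B := hAB ▸ AddSubgroup.mem_top x
    obtain ⟨a, ha, b, hb, rfl⟩ := AddSubgroup.mem_sup.mp hx'
    have hbD : b ∈ D := by
      have := D.sub_mem hx (h ha)
      rwa [add_sub_cancel_left] at this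
    have hb0 : b ∈ D ⊓ D' := ⟨hbD, h' hb⟩
    rw [hDD', AddSubgroup.mem_bot] at hb0
    rw [hb0, add_zero]
    exact ha
  have hsup' : M ⊔ M' = ⊤ := by rw [sup_comm]; exact hsup
  have hinf₂₁ : C₂ ⊓ C₁ = ⊥ := by rw [inf_comm]; exact hinf₁₂
  rcases hsM with h | h <;> rcases hsM' with h' | h'
  · exact absurd ⟨h, h'⟩ (hexcl hinf₁₂ hne₂)
  · refine ⟨r, Or.inl rfl, hr, ?_, ?_⟩
    · rw [hE₁]; exact heq hsup' hinf₁₂ h h'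
    · rw [hE₂]; exact heq hsup hinf₂₁ h' h
  · refine ⟨1 - r, Or.inr rfl, hr', ?_, ?_⟩
    · rw [hE₂]; exact heq hsup' hinf₂₁ h h'
    · rw [sub_sub_cancel, hE₁]; exact heq hsup hinf₁₂ h' h
  · exact absurd ⟨h, h'⟩ (hexcl hinf₂₁ hne₁)

end Identify

end Summit.BirchSwinnertonDyer.Rank1Residual.P2.DeuringGaloisSummandEigen

end
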